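import Mathlib
import HarnessLib
import Summits.KontsevichZagierPeriods.KontsevichZagierPeriods.Theses.LinRedNormalForm
import Summits.KontsevichZagierPeriods.KontsevichZagierPeriods.Theorems.LinRedNormalFormDihedralNormalFormStubNestedReductionAux5
import Summits.KontsevichZagierPeriods.KontsevichZagierPeriods.Theorems.LinRedNormalFormDihedralNormalFormStubAtomReductionAux3

/-!
# `DihedralNormalForm`, line `torus-descent-sum-shadow`, stub `stub_nestedReduction` — Aux 8

Support file for the stub `stub_nestedReduction` (THEOREM N) of the crux `DihedralNormalForm`
(stmt-KontsevichZagierPeriods-3912, route `LinRedNormalForm`): **pushing chords forward** and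
**the base of the axis Newton–Leibniz move is an atom of one dimension less**.

* `Nested.prod_chord_pushforward`: a product of powers `(1 − y_S)^{e_S}` over any finite family of
  INTERVALS `S` of coordinates is the chord part of an atom, the exponent of `[i',j']` being the sum
  of the `e_S` with `S = [i',j']` (chords that coincide MERGE, exponents ADD).  Used here for the
  face `x_p = 1` (deleting the coordinate `p` keeps chords intervals) and later for coordinate
  permutations mapping a nested chord family onto prefixes.
* `Nested.exists_base_atom`: if `E p p = 0`, `y ↦ c·[A,E](insertNth p 1 y)` is an atom of
  dimension `n` on the open cube; if `E p p ≥ 1` it vanishes there (`Nested.base_eq_zero`).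

References: M. Kontsevich, D. Zagier, *Periods* (2001), §1.2.
-/

noncomputable section

open MeasureTheory Set

namespace Summit.KontsevichZagierPeriods.DihedralNormalForm.TorusDescent

open Literature.NumberTheory.Transcendental

namespace Nested

variable {n : ℕ}

/-! ## Chord products on the open cube -/

/-- A chord product as a product over the interval. -/
theorem cp_eq_prod_Icc (i j : Fin n) (y : Fin n → ℝ) :
    (∏ l : Fin n, if i ≤ l ∧ l ≤ j then y l else 1) = ∏ l ∈ Finset.Icc i j, y l := by
  rw [← Finset.prod_filter]
  congr 1
  ext l
  simp

/-- A product of coordinates over a finite set is in `(0, 1]` on the open cube, and `< 1` if the set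
is non-empty. -/
theorem prod_mem_of_ocube (S : Finset (Fin n)) {y : Fin n → ℝ} (hy : y ∈ ocube n) :
    0 < ∏ l ∈ S, y l ∧ ∏ l ∈ S, y l ≤ 1 ∧ (S.Nonempty → ∏ l ∈ S, y l < 1) := by
  refine ⟨Finset.prod_pos fun l _ => (hy l).1, Finset.prod_le_one (fun l _ => (hy l).1.le)
    fun l _ => (hy l).2.le, fun ⟨l₀, hl₀⟩ => ?_⟩
  rw [← Finset.mul_prod_erase _ _ hl₀]
  have h1 : ∏ l ∈ S.erase l₀, y l ≤ 1 :=
    Finset.prod_le_one (fun l _ => (hy l).1.le) fun l _ => (hy l).2.le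
  calc y l₀ * ∏ l ∈ S.erase l₀, y l ≤ y l₀ * 1 := mul_le_mul_of_nonneg_left h1 (hy l₀).1.le
    _ < 1 := by rw [mul_one]; exact (hy l₀).2

/-- Intervals with the same elements have the same endpoints. -/
theorem Icc_inj {i j i' j' : Fin n} (hij : i ≤ j) (h : Finset.Icc i j = Finset.Icc i' j') :
    i = i' ∧ j = j' := by
  have hi : i ∈ Finset.Icc i' j' := h ▸ Finset.mem_Icc.mpr ⟨le_rfl, hij⟩
  have hj : j ∈ Finset.Icc i' j' := h ▸ Finset.mem_Icc.mpr ⟨hij, le_rfl⟩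
  rw [Finset.mem_Icc] at hi hj
  have hi' : i' ∈ Finset.Icc i j := h.symm ▸ Finset.mem_Icc.mpr ⟨le_rfl, hi.1.trans hi.2⟩
  have hj' : j' ∈ Finset.Icc i j := h.symm ▸ Finset.mem_Icc.mpr ⟨hi.1.trans hi.2, le_rfl⟩
  rw [Finset.mem_Icc] at hi' hj'
  exact ⟨le_antisymm hi'.1 hi.1, le_antisymm hj.2 hj'.2⟩

/-! ## Pushing chords forward -/

/-- **Chord pushforward.**  A product of powers `(1 − y_S)^{e_S}` over a finite family of
intervals `S` is the chord part of an atom whose exponent at `[i',j']` is `Σ_{S = [i',j']} e_S`. -/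
theorem prod_chord_pushforward {σ : Type*} [DecidableEq σ] (src : Finset σ) (S : σ → Finset (Fin n))
    (ex : σ → ℤ) (hS : ∀ s ∈ src, ∃ i' j' : Fin n, i' ≤ j' ∧ S s = Finset.Icc i' j')
    {y : Fin n → ℝ} (hy : y ∈ ocube n) :
    ∏ s ∈ src, (1 - ∏ l ∈ S s, y l) ^ ex s =
      ∏ i' : Fin n, ∏ j' : Fin n, if i' ≤ j' then
        (1 - ∏ l : Fin n, if i' ≤ l ∧ l ≤ j' then y l else 1) ^
          (∑ s ∈ src.filter (fun s => S s = Finset.Icc i' j'), ex s) else 1 := by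
  induction src using Finset.induction_on with
  | empty => simp
  | insert s₀ src hs₀ ih =>
    obtain ⟨i₀, j₀, hij₀, hS₀⟩ := hS s₀ (Finset.mem_insert_self _ _)
    rw [Finset.prod_insert hs₀, ih fun s hs => hS s (Finset.mem_insert_of_mem hs)]
    -- pull the factor of `s₀` out of the double product
    have key : ∀ i' j' : Fin n, i' ≤ j' →
        (1 - ∏ l : Fin n, if i' ≤ l ∧ l ≤ j' then y l else 1) ^
          (∑ s ∈ (insert s₀ src).filter (fun s => S s = Finset.Icc i' j'), ex s) =
        (if i' = i₀ ∧ j' = j₀ then (1 - ∏ l ∈ S s₀, y l) ^ ex s₀ else 1) *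
          (1 - ∏ l : Fin n, if i' ≤ l ∧ l ≤ j' then y l else 1) ^
            (∑ s ∈ src.filter (fun s => S s = Finset.Icc i' j'), ex s) := by
      intro i' j' hij'
      rw [Finset.filter_insert]
      by_cases h : S s₀ = Finset.Icc i' j'
      · obtain ⟨rfl, rfl⟩ := Icc_inj hij₀ (hS₀.symm.trans h)
        rw [if_pos h, Finset.sum_insert (fun h' => hs₀ (Finset.mem_filter.mp h').1), if_pos ⟨rfl, rfl⟩,
          zpow_add₀ (AtomReduction.one_sub_cp_pos hij' hy).ne', hS₀, ← cp_eq_prod_Icc]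
      · rw [if_neg h, if_neg, one_mul]
        rintro ⟨rfl, rfl⟩
        exact h hS₀
    rw [Finset.prod_congr rfl fun i' _ => Finset.prod_congr rfl fun j' _ =>
      show (if i' ≤ j' then (1 - ∏ l : Fin n, if i' ≤ l ∧ l ≤ j' then y l else 1) ^
          (∑ s ∈ (insert s₀ src).filter (fun s => S s = Finset.Icc i' j'), ex s) else (1:ℝ)) =
        (if i' = i₀ ∧ j' = j₀ then (1 - ∏ l ∈ S s₀, y l) ^ ex s₀ else 1) *
          (if i' ≤ j' then (1 - ∏ l : Fin n, if i' ≤ l ∧ l ≤ j' then y l else 1) ^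
            (∑ s ∈ src.filter (fun s => S s = Finset.Icc i' j'), ex s) else 1) by
      by_cases hij' : i' ≤ j'
      · rw [if_pos hij', if_pos hij', key i' j' hij']
      · rw [if_neg hij', if_neg hij', if_neg, one_mul]
        rintro ⟨rfl, rfl⟩
        exact hij' hij₀]
    simp_rw [Finset.prod_mul_distrib]
    congr 1
    rw [Finset.prod_eq_single i₀ (fun i' _ hi' => Finset.prod_eq_one fun j' _ => by
        rw [if_neg (fun h => hi' h.1)]) (fun h => absurd (Finset.mem_univ _) h),
      Finset.prod_eq_single j₀ (fun j' _ hj' => by rw [if_neg (fun h => hj' h.2)])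
        (fun h => absurd (Finset.mem_univ _) h), if_pos ⟨rfl, rfl⟩]

/-! ## The face `x_p = 1` -/

/-- The chords of the face: the coordinates of `insertNth p · y` lying in `[i,j]`, other than `p`,
form an interval of `Fin n` (non-empty unless `[i,j] = {p}`). -/
theorem exists_face_chord_eq_Icc (p i j : Fin (n + 1)) (hij : i ≤ j) (hne : (i, j) ≠ (p, p)) :
    ∃ i' j' : Fin n, i' ≤ j' ∧
      (Finset.univ.filter fun l : Fin n => i ≤ p.succAbove l ∧ p.succAbove l ≤ j) = Finset.Icc i' j' := by
  set T := Finset.univ.filter fun l : Fin n => i ≤ p.succAbove l ∧ p.succAbove l ≤ j with hT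
  have hmem : ∀ l, l ∈ T ↔ i ≤ p.succAbove l ∧ p.succAbove l ≤ j := fun l => by simp [hT]
  obtain ⟨m, hm, hmp⟩ : ∃ m : Fin (n + 1), (i ≤ m ∧ m ≤ j) ∧ m ≠ p := by
    by_cases hi : i = p
    · refine ⟨j, ⟨hij, le_rfl⟩, fun hj => hne (Prod.ext hi hj)⟩
    · exact ⟨i, ⟨le_rfl, hij⟩, hi⟩
  obtain ⟨l₀, rfl⟩ := Fin.exists_succAbove_eq hmp
  have hne' : T.Nonempty := ⟨l₀, (hmem l₀).mpr hm⟩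
  refine ⟨T.min' hne', T.max' hne', Finset.min'_le_max' _ hne', ?_⟩
  ext l
  rw [Finset.mem_Icc]
  constructor
  · intro hl
    exact ⟨Finset.min'_le _ _ hl, Finset.le_max' _ _ hl⟩
  · rintro ⟨h1, h2⟩
    have hmin := (hmem _).mp (Finset.min'_mem T hne')
    have hmax := (hmem _).mp (Finset.max'_mem T hne')
    have hmono := Fin.strictMono_succAbove p
    exact (hmem l).mpr ⟨hmin.1.trans (hmono.monotone h1), (hmono.monotone h2).trans hmax.2⟩

/-- The chords through the face: `x_{[i,j]}(insertNth p 1 y)` is the product of the `y l` over the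
face chord. -/
theorem cp_insertNth_one (p i j : Fin (n + 1)) (y : Fin n → ℝ) :
    (∏ l : Fin (n + 1), if i ≤ l ∧ l ≤ j then (Fin.insertNth p (1:ℝ) y : Fin (n + 1) → ℝ) l else 1) =
      ∏ l ∈ Finset.univ.filter (fun l : Fin n => i ≤ p.succAbove l ∧ p.succAbove l ≤ j), y l := by
  rw [cp_insertNth, Finset.prod_filter, cof]
  split_ifs <;> simp

/-- **The base vanishes when `E p p ≥ 1`.** -/
theorem base_eq_zero (c : ℚ) (A : Fin (n + 1) → ℕ) {E : Fin (n + 1) → Fin (n + 1) → ℤ}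
    {p : Fin (n + 1)} (hE : E p p ≠ 0) (y : Fin n → ℝ) :
    atomQ (n + 1) c A E (Fin.insertNth p 1 y) = 0 := by
  rw [atomQ]
  have h0 : (∏ i : Fin (n + 1), ∏ j : Fin (n + 1), if i ≤ j then
      (1 - (∏ l : Fin (n + 1), if i ≤ l ∧ l ≤ j then (Fin.insertNth p (1:ℝ) y : Fin (n + 1) → ℝ) l
        else 1)) ^ E i j else (1:ℝ)) = 0 := by
    refine Finset.prod_eq_zero (Finset.mem_univ p) (Finset.prod_eq_zero (Finset.mem_univ p) ?_)
    rw [if_pos le_rfl, cp_insertNth_one]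
    have hempty : Finset.univ.filter (fun l : Fin n => p ≤ p.succAbove l ∧ p.succAbove l ≤ p) = ∅ := by
      refine Finset.filter_eq_empty_iff.mpr fun l _ h => ?_
      exact Fin.succAbove_ne p l (le_antisymm h.2 h.1)
    rw [hempty, Finset.prod_empty, sub_self, zero_zpow _ hE]
  rw [h0, mul_zero, mul_zero]

/-- **The base is an atom of dimension `n` when `E p p = 0`.** -/
theorem exists_base_atom (c : ℚ) (A : Fin (n + 1) → ℕ) {E : Fin (n + 1) → Fin (n + 1) → ℤ}
    {p : Fin (n + 1)} (hE : E p p = 0) :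
    ∃ (A' : Fin n → ℕ) (E' : Fin n → Fin n → ℤ), ∀ y ∈ ocube n,
      atomQ (n + 1) c A E (Fin.insertNth p 1 y) = atomQ n c A' E' y := by
  classical
  -- the source chords: all `[i,j] ≠ {p}`, pushed to the face
  set src : Finset (Fin (n + 1) × Fin (n + 1)) :=
    Finset.univ.filter fun ij => ij.1 ≤ ij.2 ∧ ij ≠ (p, p) with hsrc
  set S : Fin (n + 1) × Fin (n + 1) → Finset (Fin n) := fun ij =>
    Finset.univ.filter fun l : Fin n => ij.1 ≤ p.succAbove l ∧ p.succAbove l ≤ ij.2 with hS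
  have hSI : ∀ ij ∈ src, ∃ i' j' : Fin n, i' ≤ j' ∧ S ij = Finset.Icc i' j' := by
    intro ij hij
    simp only [hsrc, Finset.mem_filter, Finset.mem_univ, true_and] at hij
    exact exists_face_chord_eq_Icc p ij.1 ij.2 hij.1 hij.2
  refine ⟨fun l => A (p.succAbove l), fun i' j' =>
    ∑ ij ∈ src.filter (fun ij => S ij = Finset.Icc i' j'), E ij.1 ij.2, fun y hy => ?_⟩
  have hpush := prod_chord_pushforward src S (fun ij => E ij.1 ij.2) hSI hy
  rw [atomQ, atomQ, prod_pow_insertNth, one_pow, one_mul, ← hpush]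
  congr 2
  -- the chord part at the face, as a product over `src`
  simp_rw [cp_insertNth_one]
  rw [← Fintype.prod_prod_type', ← Finset.prod_filter]
  rw [← Finset.mul_prod_erase _ _ (show (p, p) ∈ Finset.univ.filter
    (fun ij : Fin (n + 1) × Fin (n + 1) => ij.1 ≤ ij.2) by simp)]
  have hpp : S (p, p) = ∅ := by
    refine Finset.filter_eq_empty_iff.mpr fun l _ h => ?_
    exact Fin.succAbove_ne p l (le_antisymm h.2 h.1)
  have herase : (Finset.univ.filter (fun ij : Fin (n + 1) × Fin (n + 1) => ij.1 ≤ ij.2)).erase (p, p) = src := by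
    ext ij
    simp only [hsrc, Finset.mem_erase, Finset.mem_filter, Finset.mem_univ, true_and]
    tauto
  rw [herase]
  change (1 - ∏ l ∈ S (p, p), y l) ^ E p p * ∏ ij ∈ src, (1 - ∏ l ∈ S ij, y l) ^ E ij.1 ij.2 = _
  rw [hpp, Finset.prod_empty, hE, zpow_zero, one_mul]

end Nested

/-- **Registered sub-goal `stub_nestedReductionAux8`**: the base of the axis Newton–Leibniz move (face `x_p = 1`, `E p p = 0`) is an atom of one dimension less (`Nested.exists_base_atom`). -/
theorem stub_nestedReductionAux8 : ∀ (n : ℕ) (c : ℚ) (A : Fin (n + 1) → ℕ) (E : Fin (n + 1) → Fin (n + 1) → ℤ) (p : Fin (n + 1)), E p p = 0 → ∃ (A' : Fin n → ℕ) (E' : Fin n → Fin n → ℤ), ∀ y ∈ {x : Fin n → ℝ | ∀ i, x i ∈ Set.Ioo (0:ℝ) 1}, (c : ℝ) * ((∏ i : Fin (n + 1), (Fin.insertNth p (1:ℝ) y) i ^ A i) * ∏ i : Fin (n + 1), ∏ j : Fin (n + 1), if i ≤ j then (1 - (∏ l : Fin (n + 1), if i ≤ l ∧ l ≤ j then (Fin.insertNth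 p (1:ℝ) y) l else 1)) ^ E i j else 1) = (c : ℝ) * ((∏ i : Fin n, y i ^ A' i) * ∏ i : Fin n, ∏ j : Fin n, if i ≤ j then (1 - (∏ l : Fin n, if i ≤ l ∧ l ≤ j then y l else 1)) ^ E' i j else 1) :=
  fun _ c A _ _ hE =>
    Nested.exists_base_atom c A hE

end Summit.KontsevichZagierPeriods.DihedralNormalForm.TorusDescent
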